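import Summits.Ventures.HSemireg.WedgeHankelRecurrenceGaussChebyshevNestedRadicals

/-!
# Venture HSemireg — **THE DYADIC PRODUCT FORMULA IN EVERY COMMUTATIVE RING: `S_{2^n − 1} = ∏_{k<n} C_{2^k}` (i.e. `sin(2ⁿθ) = sin θ · ∏_{k<n} 2cos(2^k θ)`), from the doubling rule `C_m·S_{m−1} = S_{2m−1}`;
# consequences: `sin(2ⁿθ) = sin θ·∏_{k<n} 2cos(2^kθ)` for real `θ`, and VIÈTE'S FINITE FORMULA `sin(π∕2^{n+1})·∏_{k<n} 2cos(2^kπ∕2^{n+1}) = 1`**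

HONEST FRAMING. Part of the Lean index of the computation cell `pub-hsemireg` (seat p10 gen 49, Sunday typer «UNIFORM-IN-n»).  Polynomial algebra over a commutative ring and real trigonometry (Mathlib
`Polynomial.Chebyshev.S ∕ C`, `Finset.prod`, `Real.sin ∕ cos`); no variety, no cohomology theory, no sheaf, no Ext group and no semiregularity map is constructed here; nothing here says that HC / HC_CM / HC_AV
holds; no Literature fact (unproved `Prop`) is declared or used.  Custodian versions as in `WedgeHankelSiegelIdeal` (1/3).
SOURCES (cited).  F. Viète (1593), `2∕π = ∏_{k≥1} cos(π∕2^{k+1})`; I. S. Gradshteyn, I. M. Ryzhik, *Table*, 1.439.1 (`sin(2ⁿx) = 2ⁿ sin x ∏_{k<n} cos(2^k x)`); T. J. Rivlin, *The Chebyshev Polynomials* (Wiley 1974),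
§1.1, Ch. 4 (doubling map, `U_{2m−1} = 2T_mU_{m−1}`).
PROOF TYPED HERE.  `C_m·S_{m−1} = S_{2m−1} + S_{−1} = S_{2m−1}` (§1246 `chebyshevC_mul_S`, Mathlib `S_neg_one`); induction on `n` with `2·2^n − 1 = 2^{n+1} − 1` and `Finset.prod_range_succ`; evaluation at
`2cos θ` (Mathlib `S_two_mul_real_cos`, `C_two_mul_real_cos`, `eval_prod`); `θ = π∕2^{n+1}` gives `sin(2ⁿθ) = sin(π∕2) = 1`.
DEDUP DISCLOSURE (`rg -n 'S R \\(2 \\* . - 1\\)|∏ .*C R \\(\\(2 \\^|sin \\(2 \\^ . \\*' Summits/Ventures/HSemireg Literature Mathlib…Trigonometric`, 2026-09-05): the doubling rule is the `k = m − 1` case of §1246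
`chebyshevC_mul_S` (one line, recorded for use); half-angle factorisations `C_{2m} − 2 = (X²−4)S_{m−1}²` etc. are N478 ∕ N485; `Literature.Combinatorics.Optimization.RegularPolygonPsdLifts` uses
`cos(2^k θ)` levels privately (no product formula); Mathlib has `Real.sin_two_mul` and `cos_pi_over_two_pow` only; neither the polynomial dyadic product nor Viète's finite formula is typed; 0 hits for the
4 names below.

WHAT IS IN THE TREE.  §1246 `chebyshevC_mul_S`; Mathlib `S_neg_one`, `S_zero`, `Finset.prod_range_succ`, `S_two_mul_real_cos`, `C_two_mul_real_cos`, `eval_prod`, `Real.sin_pi_div_two`.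
THIS FILE (namespace `Summit.Ventures.HSemireg.Wedge.HankelOuter` continued; CHAINED on N556; 0 definitions):
* §1322 `chebyshevC_mul_S_pred` (`C_m·S_{m−1} = S_{2m−1}`, all `m ∈ ℤ`), **`chebyshevS_two_pow_sub_one_eq_prod`** (`S_{2^n−1} = ∏_{k<n} C_{2^k}`, every commutative ring), **`sin_two_pow_mul_eq_prod`**
  (`sin(2ⁿθ) = sin θ·∏_{k<n} 2cos(2^kθ)`), **`viete_finite_product`** (`sin(π∕2^{n+1})·∏_{k<n} 2cos(2^kπ∕2^{n+1}) = 1`).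
CAVEATS.  `n ∈ ℕ`; the infinite Viète product (limit `2ⁿ sin(π∕2^{n+1}) → π∕2`) is not typed here.  Nothing Ext-side.  New names only.
-/

open Module Polynomial
open scoped Matrix Polynomial

namespace Summit.Ventures.HSemireg.Wedge.HankelOuter

/-! ## §1322. The dyadic product formula -/

/-- `C_m·S_{m−1} = S_{2m−1}` for all `m ∈ ℤ` (the `k = m − 1` case of §1246 `chebyshevC_mul_S`; at `x = 2cos θ`: `2cos(mθ)·sin(mθ) = sin(2mθ)`). [Rivlin 1974, §1.1; this file, §1322] -/
theorem chebyshevC_mul_S_pred {R : Type*} [CommRing R] (m : ℤ) :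
    Polynomial.Chebyshev.C R m * Polynomial.Chebyshev.S R (m - 1) = Polynomial.Chebyshev.S R (2 * m - 1) := by
  rw [chebyshevC_mul_S, show m - 1 + m = 2 * m - 1 by ring, show m - 1 - m = -1 by ring, Polynomial.Chebyshev.S_neg_one, add_zero]

/-- **`S_{2^n − 1} = ∏_{k<n} C_{2^k}`** in every commutative ring (`sin(2ⁿθ)∕sin θ = ∏_{k<n} 2cos(2^kθ)` in polynomial form; `n = 2`: `S_3 = X(X² − 2)`). [Gradshteyn–Ryzhik 1.439.1; this file, §1322] -/
theorem chebyshevS_two_pow_sub_one_eq_prod (R : Type*) [CommRing R] (n : ℕ) :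
    Polynomial.Chebyshev.S R (((2 ^ n : ℕ) : ℤ) - 1) = ∏ k ∈ Finset.range n, Polynomial.Chebyshev.C R ((2 ^ k : ℕ) : ℤ) := by
  induction n with
  | zero => simp
  | succ n ih =>
    rw [Finset.prod_range_succ, ← ih, mul_comm, chebyshevC_mul_S_pred]
    congr 1
    push_cast
    ring

/-- **`sin(2ⁿθ) = sin θ · ∏_{k<n} 2cos(2^kθ)`** for real `θ`. [Gradshteyn–Ryzhik 1.439.1; this file, §1322] -/
theorem sin_two_pow_mul_eq_prod (n : ℕ) (θ : ℝ) : Real.sin (2 ^ n * θ) = Real.sin θ * ∏ k ∈ Finset.range n, 2 * Real.cos (2 ^ k * θ) := by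
  have h := Polynomial.Chebyshev.S_two_mul_real_cos θ (((2 ^ n : ℕ) : ℤ) - 1)
  rw [chebyshevS_two_pow_sub_one_eq_prod, eval_prod] at h
  simp only [Polynomial.Chebyshev.C_two_mul_real_cos] at h
  push_cast at h
  rw [sub_add_cancel] at h
  rw [← h, mul_comm]

/-- **Viète's finite formula: `sin(π∕2^{n+1}) · ∏_{k<n} 2cos(2^k·π∕2^{n+1}) = 1`** (the factors are `2cos(π∕2^{n+1}), 2cos(π∕2ⁿ), …, 2cos(π∕4)`; letting `n → ∞`, `2ⁿsin(π∕2^{n+1}) → π∕2` gives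
`2∕π = ∏_{k≥1} cos(π∕2^{k+1})`). [Viète 1593; this file, §1322] -/
theorem viete_finite_product (n : ℕ) : Real.sin (Real.pi / 2 ^ (n + 1)) * ∏ k ∈ Finset.range n, 2 * Real.cos (2 ^ k * (Real.pi / 2 ^ (n + 1))) = 1 := by
  rw [← sin_two_pow_mul_eq_prod, show (2 : ℝ) ^ n * (Real.pi / 2 ^ (n + 1)) = Real.pi / 2 by rw [pow_succ]; field_simp, Real.sin_pi_div_two]

end Summit.Ventures.HSemireg.Wedge.HankelOuter
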